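import Summits.BirchSwinnertonDyer.Rank1Residual.Additive.X4SharpThreeAssemblyManinFree
import HarnessLib

/-!
# X4♯(3), certified rows with `3 ∣ #Ш_an`: the Cassels–Tate squeeze WITHOUT the Manin datum (cell `b2b-bsdres`, team n1011 row T-b5; seat p08)

HONEST FRAMING (cell `b2b-bsdres`, run/shared/lean/b2b/bsd-rank1-residual/, verbatim in every
file): the goal of the cell is to DELETE the COMBINATION-SHAPED residual classes of the
Birch–Swinnerton-Dyer formula for ALL analytic-rank `≤ 1` elliptic curves over `ℚ` — "full BSD
formula for every rank `≤ 1` curve in class `C`" assembled STRICTLY from published theorems — so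
that the rank-`≤ 1` remainder becomes exactly the CONSTRUCTION-SHAPED classes, which are TYPED
(missing-input `Prop`s), NOT attempted. This is not "finishing BSD". Team n1011 (N10 / N11): prove
what is provable now; shrink each hard class to its core with data; no claim beyond stated classes;
research routes; census output = EVIDENCE / conjecture items, never a Literature fact; RESIDUAL-MAP
marks change only by signed lines; nothing is booked by this file.

Theorems only (no definition, no new named fact). The Manin-free twins of the Cassels–Tate rows of
`X4RankZeroKatoBound.lean` (`X4RankZero.bsdp_of_kato_of_casselsTate_of_pow_dvd`,
`X4RankZero.bsdp_three_of_kato_of_surj_of_ram_of_casselsTate`) and of `X4SharpThreeAssembly.lean`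
(`X4RankZero.bsdp_three_of_kato_of_surj_of_jWitness_of_casselsTate`): `ord_p #Ш_an ≤ 2k` together with
ONE descent certificate `p^{2k−1} ∣ #Ш(E)` gives the LOWER half through Cassels–Tate
(`missingLowerBoundAt_of_casselsTate_of_pow_dvd`, Silverman X.4.14), the UPPER half is the Manin-free
sharpened Kato reading A161′ (`X4RankZero.missingUpperBoundAt_of_katoManinFree`, p253452); no
`ModularParametrizationData` / Manin binder anywhere. Also the certificate-shaped variant on the
potentially good branch with the three tower certificates of the census (`j`-witness ∨ surj(9); the
(ram) bit). Flags carried (referee A R135, A161′ ADMITTED PUB): `Kato-14.5(3)-14.16(2)-additive-potgood-reading-sharp`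
and the informational `Kato-maninFree-lattice-transport` (the integral `V_{ℤ_p}(f) ↔ T_pE` transport
under (12.5.2) is the one step not on Kato's page). Per pair; X4's label
UNCHANGED; nothing booked by this file.

References: Kato 2004 [Kato2004Asterisque] Thm. 14.5 (3) (p. 236), Prop. 14.16 (2) (p. 244);
Silverman AEC [SilvermanAEC2009] Thm. X.4.14 (Cassels–Tate); Miller 2011 [Miller2011LMS] Def. 1.1.
-/

noncomputable section

open scoped Classical

open WeierstrassCurve Literature.NumberTheory.EllipticCurves
  Literature.NumberTheory.EllipticCurves.ModularForms
  Literature.NumberTheory.EllipticCurves.Rank1Residual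
  Literature.NumberTheory.EllipticCurves.Rank1Residual.Typed

namespace Summit.BirchSwinnertonDyer.Rank1Residual.Additive

variable (W : WeierstrassCurve ℚ) [W.IsElliptic] [W.IsGloballyMinimal] (p : ℕ) [Fact p.Prime]

/-- **Cassels–Tate squeeze, Manin-free** (twin of `X4RankZero.bsdp_of_kato_of_casselsTate_of_pow_dvd`):
X4 ∧ `r_an = 0` ∧ `ord_p j ≥ 0` ∧ tower surjectivity ∧ `p ∤ ∏ c_ℓ` ∧ `ord_p #Ш_an ≤ 2k` ∧
`p^{2k−1} ∣ #Ш(E)` ⟹ `BSD(E,p)`. [cite: Kato2004Asterisque, Thm. 14.5 (3) (p. 236)]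
[cite: SilvermanAEC2009, Thm. X.4.14] [cite: Miller2011LMS, §1 and Def. 1.1] -/
theorem X4RankZero.bsdp_of_katoManinFree_of_casselsTate_of_pow_dvd
    (hKato : Kato2004.rankZero_padicValNat_sha_le_sub_localTamagawa_of_additive_potGood_of_imageContainsSL2_maninFree)
    (hGZK : rank_eq_analyticRank_of_analyticRank_le_one) (hmod : hasEntireLFunction_rat)
    (hCT : exists_casselsTate_pairing (K := ℚ))
    (hr : W.analyticRank = 0) (hX : ClassX4 W p) (hpot : 0 ≤ padicValRat p W.j)
    (hsurj : ∀ n : ℕ, W.HasSurjectiveModNGaloisRep (p ^ n : ℕ)) (htam : ¬ p ∣ W.tamagawaProduct)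
    {q : ℚ} (hq : shaAn W = (q : ℂ)) {k : ℕ} (hv : padicValRat p q ≤ 2 * k)
    (hdvd : p ^ (2 * k - 1) ∣ W.shaOrder) : BSDp W p :=
  bsdp_of_missingPPartAt W p hGZK (by rw [hr]; exact zero_le_one)
    (missingPPartAt_of_lower_of_upper W p
      (missingLowerBoundAt_of_casselsTate_of_pow_dvd W p hCT (hGZK W (by rw [hr]; exact zero_le_one)).2
        hq hv hdvd)
      (X4RankZero.missingUpperBoundAt_of_katoManinFree W p hKato hGZK hmod hr hX hpot hsurj
        (padicValNat_tamagawaProduct_eq_localTamagawa_of_not_dvd W p htam)))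

/-- **Census shape at `p = 3` for the `#Ш_an = 9` rows, Manin-free** (twin of
`X4RankZero.bsdp_three_of_kato_of_surj_of_ram_of_casselsTate`): surj(3) ∧ ram(3) ∧ `ord_3 j ≥ 0` ∧
`3 ∤ ∏ c_ℓ` ∧ `ord_3 #Ш_an ≤ 2` ∧ ONE 3-descent certificate `3 ∣ #Ш(E)` ⟹ `BSD(E,3)`.
[cite: Kato2004Asterisque, Thm. 14.5 (3) (p. 236)] [cite: SilvermanAEC2009, Thm. X.4.14] [cite: Miller2011LMS, §1 and Def. 1.1] -/
theorem X4RankZero.bsdp_three_of_katoManinFree_of_surj_of_ram_of_casselsTate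
    (hKato : Kato2004.rankZero_padicValNat_sha_le_sub_localTamagawa_of_additive_potGood_of_imageContainsSL2_maninFree)
    (hGZK : rank_eq_analyticRank_of_analyticRank_le_one) (hmod : hasEntireLFunction_rat)
    (hCT : exists_casselsTate_pairing (K := ℚ))
    (hr : W.analyticRank = 0) (hX : ClassX4 W 3) (hpot : 0 ≤ padicValRat 3 W.j) (hsurj : Surj W 3)
    (hram : Ram W 3) (htam : ¬ 3 ∣ W.tamagawaProduct)
    {q : ℚ} (hq : shaAn W = (q : ℂ)) (hv : padicValRat 3 q ≤ 2) (hdvd : 3 ∣ W.shaOrder) : BSDp W 3 :=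
  X4RankZero.bsdp_of_katoManinFree_of_casselsTate_of_pow_dvd W 3 hKato hGZK hmod hCT hr hX hpot
    (hasSurjectiveModNGaloisRep_pow_of_hasMultiplicativeReductionAtPrime W 3 hsurj hram) htam hq
    (k := 1) (by simpa using hv) (by simpa using hdvd)

/-- **The `3 ∣ #Ш_an` rows with a `j`-witness: Cassels–Tate squeeze, Manin-free** (twin of
`X4RankZero.bsdp_three_of_kato_of_surj_of_jWitness_of_casselsTate`).
[cite: Kato2004Asterisque, Thm. 14.5 (3) (p. 236)] [cite: SilvermanAEC2009, Thm. X.4.14] [cite: Miller2011LMS, §1 and Def. 1.1] -/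
theorem X4RankZero.bsdp_three_of_katoManinFree_of_surj_of_jWitness_of_casselsTate
    (hKato : Kato2004.rankZero_padicValNat_sha_le_sub_localTamagawa_of_additive_potGood_of_imageContainsSL2_maninFree)
    (hGZK : rank_eq_analyticRank_of_analyticRank_le_one) (hmod : hasEntireLFunction_rat)
    (hCT : exists_casselsTate_pairing (K := ℚ))
    (hr : W.analyticRank = 0) (hX : ClassX4 W 3) (hpot : 0 ≤ padicValRat 3 W.j) (hsurj : Surj W 3)
    (hJ : ∃ q : ℕ, q.Prime ∧ q ≠ 3 ∧ padicValRat q W.j < 0 ∧ ¬ (3 : ℤ) ∣ padicValRat q W.j)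
    (htam : ¬ 3 ∣ W.tamagawaProduct)
    {q : ℚ} (hq : shaAn W = (q : ℂ)) {k : ℕ} (hv : padicValRat 3 q ≤ 2 * k)
    (hdvd : 3 ^ (2 * k - 1) ∣ W.shaOrder) : BSDp W 3 :=
  X4RankZero.bsdp_of_katoManinFree_of_casselsTate_of_pow_dvd W 3 hKato hGZK hmod hCT hr hX hpot
    (towerSurj_three_of_surj_of_jWitness W hsurj hJ) htam hq hv hdvd

/-- **The `3 ∣ #Ш_an` potentially-good rows with ANY census tower certificate (`j`-witness ∨ surj(9)),
Manin-free Cassels–Tate squeeze.** [cite: Kato2004Asterisque, Thm. 14.5 (3) (p. 236)]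
[cite: SilvermanAEC2009, Thm. X.4.14] [cite: Miller2011LMS, §1 and Def. 1.1] -/
theorem X4RankZero.bsdp_three_of_katoManinFree_of_towerCert_of_casselsTate
    (hKato : Kato2004.rankZero_padicValNat_sha_le_sub_localTamagawa_of_additive_potGood_of_imageContainsSL2_maninFree)
    (hGZK : rank_eq_analyticRank_of_analyticRank_le_one) (hmod : hasEntireLFunction_rat)
    (hCT : exists_casselsTate_pairing (K := ℚ))
    (hr : W.analyticRank = 0) (hX : ClassX4 W 3) (hpot : 0 ≤ padicValRat 3 W.j) (hsurj : Surj W 3)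
    (hcert : (∃ q : ℕ, q.Prime ∧ q ≠ 3 ∧ padicValRat q W.j < 0 ∧ ¬ (3 : ℤ) ∣ padicValRat q W.j) ∨
      W.HasSurjectiveModNGaloisRep 9)
    (htam : ¬ 3 ∣ W.tamagawaProduct)
    {q : ℚ} (hq : shaAn W = (q : ℂ)) {k : ℕ} (hv : padicValRat 3 q ≤ 2 * k)
    (hdvd : 3 ^ (2 * k - 1) ∣ W.shaOrder) : BSDp W 3 :=
  X4RankZero.bsdp_of_katoManinFree_of_casselsTate_of_pow_dvd W 3 hKato hGZK hmod hCT hr hX hpot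
    (towerSurj_three_of_surj_of_jWitness_or_nine W hsurj hcert) htam hq hv hdvd

end Summit.BirchSwinnertonDyer.Rank1Residual.Additive

end
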